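import Summits.ValiantsHypothesis.ValiantsHypothesis.Theorems.LacunarySymmetroidMatrixDescartesPivotRankOneFourCover
import Summits.ValiantsHypothesis.ValiantsHypothesis.Theorems.LacunarySymmetroidMatrixDescartesCensusEndWindowRev

/-!
# `MatrixDescartes` census — RANK-ONE `(2,4)₁`, THE WHOLE 2/2 SPLIT: `Z₊ ≤ 8 = 2K`
# (mirror chamber (A) by `X ↦ 1/X`, and the three pieces assembled)

HONEST FRAMING.  Object-search cell `pub-symmetroid`, seat `val-sym-mdr-p1` (generation 15); helper file `--supports` the crux item
stmt-ValiantsHypothesis-18050 (`Theses.LacunarySymmetroid.MatrixDescartes`, OPEN, on HOLD) with NO closure claim.  A sub-family law beside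
the crux (m = 2 pivot column, four RANK-ONE letters, two below and two above the pivot); the 1/3 and 3/1 splits (chambers (C), (C′) of
`…PivotRankOneReductionOneThree`, Descartes-with-parity `9`) and rank-two letters are NOT treated, so the rank-one register
`(2,4)₁ ∈ {8, 9, 10}` of record moves only for the 2/2 split.  Nothing here bears on `MatrixDescartes` in its window, on `DoorA26` / `DoorA34`,
registers / credences, or `VP ≠ VNP`.

**THEOREM (`rankOne_twoTwo_posRoots_le_eight`).**  For every real symmetric `2 × 2` matrix `J`, all `v₀, …, v₃ ∈ ℝ²`, all weights
`wₖ > 0` and all exponents `d₀ < d₁ < e < d₂ < d₃`, the determinant of `X^e J + ∑ₖ wₖ X^{dₖ} vₖvₖᵀ` has AT MOST EIGHT distinct positive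
roots — the conjectured value `2K` of the `(2, 4)` pivot row, attained (`…PivotRankOneEight`).
PROOF.  Three kernel pieces: off the two interleaving chambers (A), (B) Descartes' rule with the gap law gives `8`
(`RankOneReduction.rankOne_posRoots_le_eight_of_not_interleaving`, g13); on chamber (B) the covering theorem
(`RankOneCover.rankOne_chamberB_posRoots_le_eight`, g15); chamber (A) is the image of (B) under `X ↦ 1/X` with the letters relabelled
`3, 2, 1, 0` (`reflect_det_rankOne_four` + `Census.card_posRoots_le_card_posRoots_reflect`), proved here (`rankOne_chamberA_posRoots_le_eight`).

[folklore] Reflection of polynomials (Mathlib `Polynomial.reflect`); the lineage's files cited above.  No definitions, no named facts.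
-/

-- `Summit.ValiantsHypothesis.ValiantsHypothesis.…` repeats a component by the D-0017 layout
-- (single-conjunct summit), which the `dupNamespace` linter flags; the name is mandated.
set_option linter.dupNamespace false

open Polynomial Matrix Finset
open scoped BigOperators
open Summit.ValiantsHypothesis.ValiantsHypothesis.Theorems.LacunarySymmetroidMatrixDescartes.Pivot.TwoDirections.BlockLaw

namespace Summit.ValiantsHypothesis.ValiantsHypothesis.Theorems.LacunarySymmetroidMatrixDescartes.Pivot.RankOneCover

/-! ## 1. Reversal of the rank-one four-letter pencil -/

/-- **Reversal.**  For `N` at least every exponent, `X^{2N} · det F(1/X)` (Mathlib `reflect (N+N)`) of the pencil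
`X^e J + ∑ₖ wₖ X^{dₖ} vₖvₖᵀ` is the determinant of the same pencil with exponents `N − ·`. [folklore] -/
theorem reflect_det_rankOne_four (e d₀ d₁ d₂ d₃ N : ℕ) (J : Matrix (Fin 2) (Fin 2) ℝ) (v₀ v₁ v₂ v₃ : Fin 2 → ℝ)
    (w₀ w₁ w₂ w₃ : ℝ) (he : e ≤ N) (h₀ : d₀ ≤ N) (h₁ : d₁ ≤ N) (h₂ : d₂ ≤ N) (h₃ : d₃ ≤ N) :
    reflect (N + N) (Matrix.det (((X : ℝ[X]) ^ e) • J.map Polynomial.C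
        + (Polynomial.C w₀ * X ^ d₀) • (vecMulVec v₀ v₀).map Polynomial.C
        + (Polynomial.C w₁ * X ^ d₁) • (vecMulVec v₁ v₁).map Polynomial.C
        + (Polynomial.C w₂ * X ^ d₂) • (vecMulVec v₂ v₂).map Polynomial.C
        + (Polynomial.C w₃ * X ^ d₃) • (vecMulVec v₃ v₃).map Polynomial.C))
      = Matrix.det (((X : ℝ[X]) ^ (N - e)) • J.map Polynomial.C
        + (Polynomial.C w₀ * X ^ (N - d₀)) • (vecMulVec v₀ v₀).map Polynomial.C
        + (Polynomial.C w₁ * X ^ (N - d₁)) • (vecMulVec v₁ v₁).map Polynomial.C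
        + (Polynomial.C w₂ * X ^ (N - d₂)) • (vecMulVec v₂ v₂).map Polynomial.C
        + (Polynomial.C w₃ * X ^ (N - d₃)) • (vecMulVec v₃ v₃).map Polynomial.C) := by
  rw [det_rankOne_four, det_rankOne_four]
  simp only [reflect_add, reflect_C_mul_X_pow]
  have r0 : revAt (N + N) (2 * e) = 2 * (N - e) := by rw [revAt_le (by omega)]; omega
  have r1 : revAt (N + N) (e + d₀) = N - e + (N - d₀) := by rw [revAt_le (by omega)]; omega
  have r2 : revAt (N + N) (e + d₁) = N - e + (N - d₁) := by rw [revAt_le (by omega)]; omega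
  have r3 : revAt (N + N) (e + d₂) = N - e + (N - d₂) := by rw [revAt_le (by omega)]; omega
  have r4 : revAt (N + N) (e + d₃) = N - e + (N - d₃) := by rw [revAt_le (by omega)]; omega
  have r5 : revAt (N + N) (d₀ + d₁) = N - d₀ + (N - d₁) := by rw [revAt_le (by omega)]; omega
  have r6 : revAt (N + N) (d₀ + d₂) = N - d₀ + (N - d₂) := by rw [revAt_le (by omega)]; omega
  have r7 : revAt (N + N) (d₀ + d₃) = N - d₀ + (N - d₃) := by rw [revAt_le (by omega)]; omega
  have r8 : revAt (N + N) (d₁ + d₂) = N - d₁ + (N - d₂) := by rw [revAt_le (by omega)]; omega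
  have r9 : revAt (N + N) (d₁ + d₃) = N - d₁ + (N - d₃) := by rw [revAt_le (by omega)]; omega
  have r10 : revAt (N + N) (d₂ + d₃) = N - d₂ + (N - d₃) := by rw [revAt_le (by omega)]; omega
  rw [r0, r1, r2, r3, r4, r5, r6, r7, r8, r9, r10]

/-- The determinant of the rank-one four-letter pencil has degree at most `2N` for `N` at least every exponent. [folklore] -/
theorem natDegree_det_rankOne_four_le (e d₀ d₁ d₂ d₃ N : ℕ) (J : Matrix (Fin 2) (Fin 2) ℝ) (v₀ v₁ v₂ v₃ : Fin 2 → ℝ)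
    (w₀ w₁ w₂ w₃ : ℝ) (he : e ≤ N) (h₀ : d₀ ≤ N) (h₁ : d₁ ≤ N) (h₂ : d₂ ≤ N) (h₃ : d₃ ≤ N) :
    (Matrix.det (((X : ℝ[X]) ^ e) • J.map Polynomial.C
        + (Polynomial.C w₀ * X ^ d₀) • (vecMulVec v₀ v₀).map Polynomial.C
        + (Polynomial.C w₁ * X ^ d₁) • (vecMulVec v₁ v₁).map Polynomial.C
        + (Polynomial.C w₂ * X ^ d₂) • (vecMulVec v₂ v₂).map Polynomial.C
        + (Polynomial.C w₃ * X ^ d₃) • (vecMulVec v₃ v₃).map Polynomial.C)).natDegree ≤ N + N := by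
  rw [det_rankOne_four]
  have t : ∀ (c : ℝ) (n : ℕ), n ≤ N + N → (Polynomial.C c * X ^ n).natDegree ≤ N + N :=
    fun c n hn => (natDegree_C_mul_X_pow_le c n).trans hn
  refine (natDegree_add_le _ _).trans (max_le ?_ (t _ _ (by omega)))
  refine (natDegree_add_le _ _).trans (max_le ?_ (t _ _ (by omega)))
  refine (natDegree_add_le _ _).trans (max_le ?_ (t _ _ (by omega)))
  refine (natDegree_add_le _ _).trans (max_le ?_ (t _ _ (by omega)))
  refine (natDegree_add_le _ _).trans (max_le ?_ (t _ _ (by omega)))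
  refine (natDegree_add_le _ _).trans (max_le ?_ (t _ _ (by omega)))
  refine (natDegree_add_le _ _).trans (max_le ?_ (t _ _ (by omega)))
  refine (natDegree_add_le _ _).trans (max_le ?_ (t _ _ (by omega)))
  refine (natDegree_add_le _ _).trans (max_le ?_ (t _ _ (by omega)))
  refine (natDegree_add_le _ _).trans (max_le ?_ (t _ _ (by omega)))
  exact t _ _ (by omega)

/-! ## 2. The mirror chamber (A) -/

/-- **RANK-ONE `(2,4)₁` IN THE MIRROR CHAMBER (A): `Z₊ ≤ 8`** (`J` real symmetric, `wₖ > 0`, `vₖ` arbitrary; exponents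
`d₀ < d₁ < e < d₂ < d₃` with `e + d₁ < d₀ + d₃ < 2e < d₁ + d₂`, `e + d₂ < d₁ + d₃`) — the reflection `X ↦ 1/X` of chamber (B) with the
letters relabelled `3, 2, 1, 0`. [this file] -/
theorem rankOne_chamberA_posRoots_le_eight (e d₀ d₁ d₂ d₃ : ℕ) (h01 : d₀ < d₁) (h1e : d₁ < e) (he2 : e < d₂) (h23 : d₂ < d₃)
    (hA1 : e + d₁ < d₀ + d₃) (hA2 : d₀ + d₃ < 2 * e) (hA3 : 2 * e < d₁ + d₂) (hA4 : e + d₂ < d₁ + d₃)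
    (J : Matrix (Fin 2) (Fin 2) ℝ) (hJ : J 0 1 = J 1 0) (v₀ v₁ v₂ v₃ : Fin 2 → ℝ) (w₀ w₁ w₂ w₃ : ℝ)
    (hw₀ : 0 < w₀) (hw₁ : 0 < w₁) (hw₂ : 0 < w₂) (hw₃ : 0 < w₃) :
    ((Matrix.det (((X : ℝ[X]) ^ e) • J.map Polynomial.C
        + (Polynomial.C w₀ * X ^ d₀) • (vecMulVec v₀ v₀).map Polynomial.C
        + (Polynomial.C w₁ * X ^ d₁) • (vecMulVec v₁ v₁).map Polynomial.C
        + (Polynomial.C w₂ * X ^ d₂) • (vecMulVec v₂ v₂).map Polynomial.C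
        + (Polynomial.C w₃ * X ^ d₃) • (vecMulVec v₃ v₃).map Polynomial.C)).roots.toFinset.filter (fun t => 0 < t)).card
      ≤ 8 := by
  classical
  set f := Matrix.det (((X : ℝ[X]) ^ e) • J.map Polynomial.C
        + (Polynomial.C w₀ * X ^ d₀) • (vecMulVec v₀ v₀).map Polynomial.C
        + (Polynomial.C w₁ * X ^ d₁) • (vecMulVec v₁ v₁).map Polynomial.C
        + (Polynomial.C w₂ * X ^ d₂) • (vecMulVec v₂ v₂).map Polynomial.C
        + (Polynomial.C w₃ * X ^ d₃) • (vecMulVec v₃ v₃).map Polynomial.C) with hf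
  by_cases hf0 : f = 0
  · rw [hf0]; simp
  have hrefl := Census.card_posRoots_le_card_posRoots_reflect f hf0
    (natDegree_det_rankOne_four_le e d₀ d₁ d₂ d₃ d₃ J v₀ v₁ v₂ v₃ w₀ w₁ w₂ w₃ (by omega) (by omega) (by omega) (by omega) le_rfl)
  rw [hf, reflect_det_rankOne_four e d₀ d₁ d₂ d₃ d₃ J v₀ v₁ v₂ v₃ w₀ w₁ w₂ w₃ (by omega) (by omega) (by omega) (by omega) le_rfl]
    at hrefl
  -- reorder the letters: 3, 2, 1, 0
  have hre : ((X : ℝ[X]) ^ (d₃ - e)) • J.map Polynomial.C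
        + (Polynomial.C w₀ * X ^ (d₃ - d₀)) • (vecMulVec v₀ v₀).map Polynomial.C
        + (Polynomial.C w₁ * X ^ (d₃ - d₁)) • (vecMulVec v₁ v₁).map Polynomial.C
        + (Polynomial.C w₂ * X ^ (d₃ - d₂)) • (vecMulVec v₂ v₂).map Polynomial.C
        + (Polynomial.C w₃ * X ^ (d₃ - d₃)) • (vecMulVec v₃ v₃).map Polynomial.C
      = ((X : ℝ[X]) ^ (d₃ - e)) • J.map Polynomial.C
        + (Polynomial.C w₃ * X ^ (d₃ - d₃)) • (vecMulVec v₃ v₃).map Polynomial.C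
        + (Polynomial.C w₂ * X ^ (d₃ - d₂)) • (vecMulVec v₂ v₂).map Polynomial.C
        + (Polynomial.C w₁ * X ^ (d₃ - d₁)) • (vecMulVec v₁ v₁).map Polynomial.C
        + (Polynomial.C w₀ * X ^ (d₃ - d₀)) • (vecMulVec v₀ v₀).map Polynomial.C := by abel
  rw [hre] at hrefl
  exact hrefl.trans (rankOne_chamberB_posRoots_le_eight (d₃ - e) (d₃ - d₃) (d₃ - d₂) (d₃ - d₁) (d₃ - d₀)
    (by omega) (by omega) (by omega) (by omega) (by omega) (by omega) (by omega) (by omega)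
    J hJ v₃ v₂ v₁ v₀ w₃ w₂ w₁ w₀ hw₃ hw₂ hw₁ hw₀)

/-! ## 3. The whole 2/2 split -/

/-- **RANK-ONE `(2,4)₁`, TWO LETTERS BELOW AND TWO ABOVE THE PIVOT: `Z₊ ≤ 8 = 2K`** (`J` any real symmetric `2 × 2` matrix,
`vₖ ∈ ℝ²` arbitrary, `wₖ > 0`, exponents `d₀ < d₁ < e < d₂ < d₃`, no further condition).  Sharp (`…PivotRankOneEight`). [this file] -/
theorem rankOne_twoTwo_posRoots_le_eight (e d₀ d₁ d₂ d₃ : ℕ) (h01 : d₀ < d₁) (h1e : d₁ < e) (he2 : e < d₂) (h23 : d₂ < d₃)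
    (J : Matrix (Fin 2) (Fin 2) ℝ) (hJ : J 0 1 = J 1 0) (v₀ v₁ v₂ v₃ : Fin 2 → ℝ) (w₀ w₁ w₂ w₃ : ℝ)
    (hw₀ : 0 < w₀) (hw₁ : 0 < w₁) (hw₂ : 0 < w₂) (hw₃ : 0 < w₃) :
    ((Matrix.det (((X : ℝ[X]) ^ e) • J.map Polynomial.C
        + (Polynomial.C w₀ * X ^ d₀) • (vecMulVec v₀ v₀).map Polynomial.C
        + (Polynomial.C w₁ * X ^ d₁) • (vecMulVec v₁ v₁).map Polynomial.C
        + (Polynomial.C w₂ * X ^ d₂) • (vecMulVec v₂ v₂).map Polynomial.C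
        + (Polynomial.C w₃ * X ^ d₃) • (vecMulVec v₃ v₃).map Polynomial.C)).roots.toFinset.filter (fun t => 0 < t)).card
      ≤ 8 := by
  by_cases hB : d₁ + d₂ < 2 * e ∧ d₀ + d₂ < e + d₁ ∧ 2 * e < d₀ + d₃ ∧ d₀ + d₃ < e + d₂
  · obtain ⟨hB2, hB1, hB3, hB4⟩ := hB
    exact rankOne_chamberB_posRoots_le_eight e d₀ d₁ d₂ d₃ h01 h1e he2 h23 hB1 hB2 hB3 hB4 J hJ v₀ v₁ v₂ v₃ w₀ w₁ w₂ w₃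
      hw₀ hw₁ hw₂ hw₃
  by_cases hA : e + d₁ < d₀ + d₃ ∧ d₀ + d₃ < 2 * e ∧ 2 * e < d₁ + d₂ ∧ e + d₂ < d₁ + d₃
  · obtain ⟨hA1, hA2, hA3, hA4⟩ := hA
    exact rankOne_chamberA_posRoots_le_eight e d₀ d₁ d₂ d₃ h01 h1e he2 h23 hA1 hA2 hA3 hA4 J hJ v₀ v₁ v₂ v₃ w₀ w₁ w₂ w₃
      hw₀ hw₁ hw₂ hw₃
  exact RankOneReduction.rankOne_posRoots_le_eight_of_not_interleaving e d₀ d₁ d₂ d₃ h01 h1e he2 h23 hB hA J v₀ v₁ v₂ v₃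
    w₀ w₁ w₂ w₃ hw₀.le hw₁.le hw₂.le hw₃.le

end Summit.ValiantsHypothesis.ValiantsHypothesis.Theorems.LacunarySymmetroidMatrixDescartes.Pivot.RankOneCover
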